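import Summits.BirchSwinnertonDyer.BirchSwinnertonDyer.Theorems.UniversalToricDescentToricKernelAtThreeApZeroOddOfPrint
import HarnessLib

/-!
# Route `UniversalToricDescent` — act D's KERNEL♭ `ToricKernelAtThreeApZeroOddFlatOfPrint` (item
# stmt-BirchSwinnertonDyer-25913) HOLDS

Cell `bsd-wall` (W-ALL lane 3, row 2·3@3), seat `bsd-wall-utd-p1` g11 executing the UTD pen's act-D prover
ticket (α) (planner pss3x g3, PLAN-D.md; route rev 35 renders the act-D items 25911 `ToricTransportModThreeFlat`,
25912 `TwinWanFrameAtThreeNonOrdBuckets`, 25913 `ToricKernelAtThreeApZeroOddFlatOfPrint`). The proof is the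
refuter-certified candidate of vet bsd-vet-tk5d g7 (`Combined_actD_g7.lean` sha16 b92d6ed8e641ae64, §4 + (C3),
rc 0, std axioms), landed by a prover as the gate requires:

* `bsdp_three_of_twinWanFrameAt_odd_flat` — the POINTWISE kernel of p595754 §1
  (`UniversalToricDescentKernelOdd.bsdp_three_of_twinIMCAtThreeAt_odd`) re-keyed to #2♭: transport hypothesis
  `ToricTransportModThreeFlat` and a ONE-SIDED twin (one BDP frame of `f_{W′}` with the rational Wan clause
  `∃ k, 3^k·Ch(W′)·R₀⟦T⟧ ⊆ (L′)` — spelled out, no new definition); the `Λ`-torsion of `X_ac(E)` that #2♭ asks for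
  is read off the control equality at `𝔭′` FIRST;
* `bsdp_three_of_flat_of_nonOrdBuckets_odd` — p595754 §3 / the 24911 closer's
  `bsdp_three_of_apZero_of_cellSupply_odd_of_yanZhu` re-run on (#2♭, ♭-package 25912): bucket B♭ and C₀♭
  pointwise from the package, bucket A from Yan–Zhu 5.7(1) ALONE (IMC equality ⟹ Wan clause with `k = 0`);
* **`toricKernelAtThreeApZeroOddFlatOfPrint_proof`** — the item, literally the route decl;
* `wAllExclAddWildRankOneSurjTwin_of_flat_of_nonOrdBuckets_of_print` — the rev-35 `closes` body with its kernel♭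
  hypothesis discharged (CONDITIONAL on the eight remaining displayed hypotheses).

What this does NOT do: it proves no research binder (`ToricTransportModThreeFlat` — whose children-to-be are
♭T `DefectTransportModThree` + the wall/μ package —, `TwinWanFrameAtThreeNonOrdBuckets`, `WildRankZeroTwistAtThree`
stay OPEN) and no printed package; BSD is not proved by any of this.
-/

noncomputable section

open scoped Classical

set_option linter.dupNamespace false
set_option autoImplicit false

namespace Summit.BirchSwinnertonDyer.BirchSwinnertonDyer.Theorems.UniversalToricDescentKernelFlatOfPrint

open WeierstrassCurve NumberField IsDedekindDomain Field
  Literature.NumberTheory.EllipticCurves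
  Literature.NumberTheory.EllipticCurves.ModularForms
  Literature.NumberTheory.EllipticCurves.Rank1Residual
  Literature.NumberTheory.EllipticCurves.KrizLi2019
  Literature.NumberTheory.EllipticCurves.LiuZhangZhang2018
  Summit.BirchSwinnertonDyer.Rank1Residual
  Summit.BirchSwinnertonDyer.Rank1Residual.Additive
  Summit.BirchSwinnertonDyer.Rank1Residual.X11b
  Summit.BirchSwinnertonDyer.Rank1Residual.X11b.AcSelmer
  Summit.BirchSwinnertonDyer.Rank1Residual.X11b.Halves
  Summit.BirchSwinnertonDyer.BirchSwinnertonDyer.Theses.UniversalToricDescent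
  Summit.BirchSwinnertonDyer.BirchSwinnertonDyer.Theorems
  Summit.BirchSwinnertonDyer.BirchSwinnertonDyer.Theorems.UniversalToricDescentTwinChoice
  Summit.BirchSwinnertonDyer.BirchSwinnertonDyer.Theorems.UniversalToricDescentWaldspurgerFlat
  Summit.BirchSwinnertonDyer.BirchSwinnertonDyer.Theorems.UniversalToricDescentKernelOdd
  Summit.BirchSwinnertonDyer.BirchSwinnertonDyer.Theorems.UniversalToricDescentKernelOfPrint

/-- **Pointwise kernel♭.** `UniversalToricDescentKernelOdd.bsdp_three_of_twinIMCAtThreeAt_odd` (p595754 §1)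
with `(hT : ToricTransportModThree)` ↦ `(hT : ToricTransportModThreeFlat)` (act D #2♭, item 25911) and the twin's
IMC equality `TwinIMCAtThreeAt W′` ↦ ONE BDP frame of `f_{W′}` carrying the rational Wan clause
`∃ k, 3^k·Ch(W′)·R₀⟦T⟧ ⊆ (L′)` (the pointwise ♭-twin, spelled out as `hI'`): the twin is consumed one-sidedly,
the `Λ`-torsion of `X_ac(E)` that #2♭ wants is the first component of the control count, everything else is
p595754 §1 verbatim (vet tk5d g7, `Combined_actD_g7.lean` §4, kernel-checked). CONDITIONAL on every displayed
hypothesis; BSD is proved for no curve by this. [cite: JetchevSkinnerWan2017, §7.4.1] [cite: FriedbergHoffstein1995, Thm. B] -/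
theorem bsdp_three_of_twinWanFrameAt_odd_flat (hF : ToricPublishedInputs) (hT : ToricTransportModThreeFlat)
    (hV : ∀ (W : WeierstrassCurve ℚ) [W.IsElliptic] [W.IsGloballyMinimal] (N : ℕ) [NeZero N] (K : Type)
      [Field K] [NumberField K] (Dt : ModularParametrizationData W N) (H : HeegnerDatum N (NumberField.discr K))
      (ι : K →+* ℂ) (P : (W.baseChange K).toAffine.Point),
      Additive.ClassO6 W 3 → W.HasSurjectiveModNGaloisRep 3 → W.analyticRank = 1 → W.conductorNorm ℤ = N →
      IsImaginaryQuadratic K → SatisfiesHeegnerHypothesis N K → Odd (NumberField.discr K) →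
      (W.quadraticTwist (NumberField.discr K : ℚ)).entireLFunction 1 ≠ 0 →
      (WeierstrassCurve.Affine.Point.map ι.toRatAlgHom) P = heegnerPointComplex Dt H → ¬ IsOfFinAddOrder P →
      ∀ (κ : ZpExtension K 3), κ.IsAnticyclotomic → ∀ (γ : absoluteGaloisGroup K) [Fact (κ.IsTopGenerator γ)]
        (𝔭 : HeightOneSpectrum (𝓞 K)) (h𝔭 : ((3 : ℕ) : 𝓞 K) ∈ 𝔭.asIdeal)
        (he : 𝔭.asIdeal.ramificationIdx (𝓞 ℚ) = 1) (hf : 𝔭.asIdeal.inertiaDeg (𝓞 ℚ) = 1),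
        ∃ ι' : PadicAlgCl 3 ≃+* ℂ, SchneiderFree.BranchInducesPrime 3 ι' 𝔭 ∧
          ∃ (ΩK : ℂ) (Ωp : ℂ_[3]) (L : UnrSeries 3), ΩK ≠ 0 ∧ Ωp ≠ 0 ∧ IsBDPLFunction ι' 𝔭 κ γ Dt.f ΩK Ωp L ∧
            ∃ u : (unrIntegers 3)ˣ, L.HasValueAt 0 ((((u : unrIntegers 3) : unrIntegers 3) : ℂ_[3]) *
              (algebraMap ℚ_[3] ℂ_[3] (logOmega W 3 (embAt K 3 𝔭 h𝔭 he hf) P / (Dt.c : ℚ_[3]))) ^ 2))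
    (hC : WildSplitControlAtThree) (hZ : WildRankZeroTwistAtThree)
    (W : WeierstrassCurve ℚ) [W.IsElliptic] [W.IsGloballyMinimal]
    (hO6 : Additive.ClassO6 W 3) (hr : W.analyticRank = 1) (hsurj : W.HasSurjectiveModNGaloisRep 3)
    (W' : WeierstrassCurve ℚ) [W'.IsElliptic] [W'.IsGloballyMinimal]
    (hcong : O6.ModPCongruent W' W 3) (hW'ss : ¬ Addv W' 3)
    (hI' : ∀ (N' : ℕ) [NeZero N'] (K : Type) [Field K] [NumberField K]
      (Dt' : ModularParametrizationData W' N'), W'.conductorNorm ℤ = N' → IsImaginaryQuadratic K →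
      SatisfiesHeegnerHypothesis N' K → Odd (NumberField.discr K) →
      ∀ (κ : ZpExtension K 3), κ.IsAnticyclotomic →
      ∀ (γ : absoluteGaloisGroup K) [Fact (κ.IsTopGenerator γ)] (𝔭 : HeightOneSpectrum (𝓞 K)),
        ((3 : ℕ) : 𝓞 K) ∈ 𝔭.asIdeal → 𝔭.asIdeal.ramificationIdx (𝓞 ℚ) = 1 →
        𝔭.asIdeal.inertiaDeg (𝓞 ℚ) = 1 →
      ∀ (𝔭' : HeightOneSpectrum (𝓞 K)), ((3 : ℕ) : 𝓞 K) ∈ 𝔭'.asIdeal → 𝔭' ≠ 𝔭 →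
      ∀ (ι' : PadicAlgCl 3 ≃+* ℂ), SchneiderFree.BranchInducesPrime 3 ι' 𝔭 →
        ∃ (ΩK : ℂ) (Ωp : ℂ_[3]) (L' : UnrSeries 3), ΩK ≠ 0 ∧ Ωp ≠ 0 ∧
          IsBDPLFunction ι' 𝔭 κ γ Dt'.f ΩK Ωp L' ∧
          ∃ k : ℕ, ∀ G ∈ (XAc.charIdeal (W'.baseChange K) 3 κ 𝔭' ∅ γ).map (PowerSeries.map (toUnr 3)),
            PowerSeries.C (((3 : ℕ) : unrIntegers 3) ^ k) * G ∈ Ideal.span {L'}) :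
    BSDp W 3 := by
  obtain ⟨hGZ, hKo, hGZK, hmod, hmodP, -, hGZ73, hFH, hpar, hHP⟩ := hF
  haveI hN0 : NeZero (W.conductorNorm ℤ) := ⟨W.conductorNorm_pos_holds.ne'⟩
  haveI hN0' : NeZero (W'.conductorNorm ℤ) := ⟨W'.conductorNorm_pos_holds.ne'⟩
  -- (a) DATA. parity: `r_an = 1` is odd, so `w(E) = -1`
  have hw : W.rootNumber = -1 := by
    rcases W.rootNumber_eq_one_or with h | h
    · exfalso
      have heven : Even W.analyticRank := (hpar W).mpr h
      rw [hr] at heven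
      exact Nat.not_even_one heven
    · exact h
  -- Friedberg–Hoffstein with auxiliary modulus `2·N(E′)`: Heegner for `N(E)`, `N(E′)`, and `2` split
  obtain ⟨K, _, _, hK, -, hHN, hH2N', hLt⟩ :=
    hFH W hw (2 * W'.conductorNorm ℤ) (mul_ne_zero two_ne_zero hN0'.out) 0
  have hHN' : SatisfiesHeegnerHypothesis (W'.conductorNorm ℤ) K :=
    SatisfiesHeegnerHypothesis.of_dvd (dvd_mul_left _ 2) hH2N'
  have hodd : Odd (NumberField.discr K) := by
    have h8 := Literature.SatisfiesHeegnerHypothesis.discr_emod_eight hK.1 hH2N' (dvd_mul_right 2 _)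
    rw [Int.odd_iff]; omega
  -- `3 ∣ N(E)` (additive) splits in `K`
  have h3N : 3 ∣ W.conductorNorm ℤ :=
    (W.dvd_conductorNorm_iff_not_hasGoodReductionAtPrime 3).mpr (not_good_of_addv W 3 hO6.2.1)
  have hsplit : SplitsIn K 3 := hHN 3 Nat.prime_three h3N
  -- the Heegner point over `K` and its data; non-torsion by Gross–Zagier
  obtain ⟨P, Dt, H, ι, hP⟩ := hHP W K hK hHN
  have hL0 : W.entireLFunction 1 = 0 := entireLFunction_one_eq_zero_of_analyticRank_eq_one hr
  obtain ⟨-, hderiv⟩ := leadingLCoeff_eq_deriv_of_analyticRank_eq_one hr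
  have hLK : LDerivEK W K ≠ 0 := by
    rw [lDerivEK_eq_deriv_mul W K hmod hL0]; exact mul_ne_zero hderiv hLt
  have hnt : ¬ IsOfFinAddOrder P :=
    (lDerivEK_ne_zero_iff_not_isOfFinAddOrder W (W.conductorNorm ℤ) K (hGZ _ W K) hK hHN
      ⟨Dt, H, ι, hP⟩).mp hLK
  -- Kolyvagin: `rank E(K) = 1`, `Ш(E/K)` finite
  obtain ⟨hrk, hfin⟩ := hKo (W.conductorNorm ℤ) W K hK hHN ⟨Dt, H, ι, hP⟩ hnt
  -- the twin's parametrisation datum (modularity)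
  obtain ⟨Dt'⟩ := hmodP W'
  -- a frame `(κ, γ, 𝔭)` and the other prime `𝔭′ ≠ 𝔭` above `3`
  obtain ⟨κ, γ, -, hκ, hγ, -⟩ := X11b.exists_anticyclotomic_generator_prime (p := 3) hK
  haveI : Fact (κ.IsTopGenerator γ) := ⟨hγ⟩
  obtain ⟨𝔭, h𝔭, he, hf⟩ := X11b.exists_degreeOnePrime_of_splitsIn K 3 hK.1 hsplit
  obtain ⟨𝔭', hne, h𝔭', he', hf'⟩ := X11b.Three.exists_ne_degreeOne_prime hK.1 h𝔭 he hf
  -- (b) PLUMBING. Waldspurger frame and unit value at `(κ, γ, 𝔭)` — AT THIS ODD-`d_K` FIELD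
  obtain ⟨ι', hind, ΩK, Ωp, L, hΩK, hΩp, hBDP, u, hval⟩ :=
    hV W (W.conductorNorm ℤ) K Dt H ι P hO6 hsurj hr rfl hK hHN hodd hLt hP hnt κ hκ γ 𝔭 h𝔭 he hf
  -- ♭ CHANGE 1/3: the twin's RATIONAL WAN FRAME at `(ι′, 𝔭)` with `X_ac` strict at `𝔭′` — POINTWISE, ONE-SIDED
  have hwan' := hI' (W'.conductorNorm ℤ) K Dt' rfl hK hHN' hodd κ hκ γ 𝔭 h𝔭 he hf 𝔭' h𝔭' hne ι' hind
  -- ♭ CHANGE 2/3: control EQUALITY at `𝔭′` (CTL₀ included) is read FIRST — it supplies `Λ`-torsion of `X_ac(E)`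
  have hctl : SchneiderFree.AdditiveControlOnTreeAt 3 κ 𝔭' γ (embAt K 3 𝔭' h𝔭' he' hf') P :=
    hC W (W.conductorNorm ℤ) K Dt H ι P hO6 hsurj hr rfl hK hHN hLt hP hnt (hKo _ W K) κ hκ γ 𝔭'
      h𝔭' he' hf'
  obtain ⟨n, hn, hneq⟩ := hctl
  -- ♭ CHANGE 3/3: transport♭ (wall ⊆ at E + defect transport + one-sided twin): IMC EQUALITY for `E` at `L`
  have heq : (XAc.charIdeal (W.baseChange K) 3 κ 𝔭' ∅ γ).map (PowerSeries.map (toUnr 3)) =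
      Ideal.span {L} :=
    hT W W' (W.conductorNorm ℤ) (W'.conductorNorm ℤ) K Dt Dt' hO6 hsurj hr rfl hcong hW'ss rfl hK hHN
      hHN' κ hκ γ 𝔭 h𝔭 he hf 𝔭' h𝔭' hne ι' hind hn.1 hwan' ΩK Ωp L hΩK hΩp hBDP
  -- the value read through the logarithm at `𝔭′` (rank one: `(log_{𝔭′} P)² = (log_𝔭 P)²`)
  have hval' : L.HasValueAt 0 ((((u : unrIntegers 3) : unrIntegers 3) : ℂ_[3]) *
      (algebraMap ℚ_[3] ℂ_[3]
        (logOmega W 3 (embAt K 3 𝔭' h𝔭' he' hf') P / (Dt.c : ℚ_[3]))) ^ 2) :=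
    (SchneiderFreeAdditiveX3.hasValueAt_sq_logOmega_embAt_iff_of_rank_one W 3 hK.1 hrk h𝔭 he hf
      h𝔭' he' hf' P _ _ L).mpr hval
  -- both sockets at slack `v₃(c)` at the frame `(κ, 𝔭′, γ, embAt 𝔭′)`
  have hc0 : Dt.c ≠ 0 := Dt.maninConstant_ne_zero_holds
  have hlog : logOmega W 3 (embAt K 3 𝔭' h𝔭' he' hf') P ≠ 0 := X11b.R1.logOmega_ne_zero W 3 _ hnt
  have hlow : SchneiderFree.AdditiveIMCLowerBDPOnTreeLeAt 3 κ 𝔭' γ (embAt K 3 𝔭' h𝔭' he' hf')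
      (padicValNat 3 Dt.c.natAbs) P := by
    -- the LOWER norm receptacle (`⊆` + value): `2·ord₃(log_{𝔭′}P / c) ≤ ord₃ f(0)`
    obtain ⟨htors, f, hfI, hf0, hfn⟩ := hn
    have hmem : PowerSeries.map (toUnr 3) f ∈ Ideal.span {L} := by
      have h3 := heq.le
      rw [hfI, CongruenceLimit.map_span_singleton_powerSeries] at h3
      exact (Ideal.span_singleton_le_iff_mem _).mp h3
    obtain ⟨-, hle⟩ := Supersingular.two_mul_valuation_le_of_mem_span 3 hf0 hmem u hval'
    have hc0' : (Dt.c : ℚ_[3]) ≠ 0 := by exact_mod_cast hc0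
    rw [div_eq_mul_inv, Padic.valuation_mul hlog (inv_ne_zero hc0'), Padic.valuation_inv,
      Padic.valuation_intCast, valuation_logOmega hlog, hfn] at hle
    refine ⟨n, ⟨htors, f, hfI, hf0, hfn⟩, ?_⟩
    simp only [padicValInt] at hle
    linarith
  have hup : SchneiderFree.Upper.AdditiveIMCUpperBDPOnTreeLeAt 3 κ 𝔭' γ (embAt K 3 𝔭' h𝔭' he' hf')
      (padicValNat 3 Dt.c.natAbs) P :=
    SchneiderFree.Upper.additiveIMCUpperBDPOnTreeLeAt_of_value_of_dvd' hn heq.ge u hc0 hlog hval'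
  -- the EXACT index at slack `v₃(c)` (both halves), by K1's links with the control equality
  have hlo : SchneiderFree.IndexLowerBoundLeAt W 3 K P (padicValNat 3 Dt.c.natAbs) :=
    SchneiderFreeAdditiveX3.indexLowerBoundLeAt_of_imcLowerLe_of_control rfl hK hHN hfin hlow
      ⟨n, hn, hneq⟩
  have hupI : SchneiderFree.Upper.IndexUpperBoundLeAt W 3 K P (padicValNat 3 Dt.c.natAbs) :=
    SchneiderFree.Upper.indexUpperBoundLeAt_of_imcUpperLe_of_control rfl hK hHN hfin hup ⟨n, hn, hneq⟩
  -- (c) TERMINAL STEP: a globally minimal model of the twist, then p528981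
  have hD0 : (NumberField.discr K : ℚ) ≠ 0 := by exact_mod_cast NumberField.discr_ne_zero K
  haveI : (W.quadraticTwist (NumberField.discr K : ℚ)).IsElliptic := W.isElliptic_quadraticTwist hD0
  obtain ⟨Cd, hCd⟩ := hasGlobalMinimalModel_rat_holds (W.quadraticTwist (NumberField.discr K : ℚ))
  haveI : (Cd • W.quadraticTwist (NumberField.discr K : ℚ)).IsGloballyMinimal := hCd
  exact SchneiderFree.Exact.bsdp_three_of_exactIndexManin_of_wAllExclAddWildRankZero hGZ hKo hGZK hmod
    hGZ73 hZ W hO6 hsurj hr (W.conductorNorm ℤ) K Dt H ι P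
    (Cd • W.quadraticTwist (NumberField.discr K : ℚ)) rfl hK hodd hHN hLt hP ⟨Cd, rfl⟩ hlo hupI


/-- p595754 §3 / the 24911 closer's `bsdp_three_of_apZero_of_cellSupply_odd_of_yanZhu` re-run on
(#2♭ `ToricTransportModThreeFlat`, ♭-package `TwinWanFrameAtThreeNonOrdBuckets` BY NAME): good-ss twins are traded
for the supplied `a₃ = 0` twin and served by the ♭C₀ conjunct, multiplicative twins by the ♭B conjunct, good-ordinary
twins by Yan–Zhu 5.7(1) alone (`ThreeAdicImageOverK.twinSplitIMCAtThreeGoodOrd_of_yanZhu57`, IMC equality ⟹ the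
Wan clause with `k = 0`). [folklore] -/
theorem bsdp_three_of_flat_of_nonOrdBuckets_odd (hF : ToricPublishedInputs)
    (hT : ToricTransportModThreeFlat) (hYZ : YanZhuMainConjectureInput) (h3 : TwinWanFrameAtThreeNonOrdBuckets)
    (hsupply : ∀ (W : WeierstrassCurve ℚ) [W.IsElliptic] [W.IsGloballyMinimal], Additive.ClassO6 W 3 →
      W.analyticRank = 1 → W.HasSurjectiveModNGaloisRep 3 → HasGoodSSTwinAtThree W →
      HasGoodSSApZeroTwinAtThree W)
    (hV : ∀ (W : WeierstrassCurve ℚ) [W.IsElliptic] [W.IsGloballyMinimal] (N : ℕ) [NeZero N] (K : Type)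
      [Field K] [NumberField K] (Dt : ModularParametrizationData W N) (H : HeegnerDatum N (NumberField.discr K))
      (ι : K →+* ℂ) (P : (W.baseChange K).toAffine.Point),
      Additive.ClassO6 W 3 → W.HasSurjectiveModNGaloisRep 3 → W.analyticRank = 1 → W.conductorNorm ℤ = N →
      IsImaginaryQuadratic K → SatisfiesHeegnerHypothesis N K → Odd (NumberField.discr K) →
      (W.quadraticTwist (NumberField.discr K : ℚ)).entireLFunction 1 ≠ 0 →
      (WeierstrassCurve.Affine.Point.map ι.toRatAlgHom) P = heegnerPointComplex Dt H → ¬ IsOfFinAddOrder P →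
      ∀ (κ : ZpExtension K 3), κ.IsAnticyclotomic → ∀ (γ : absoluteGaloisGroup K) [Fact (κ.IsTopGenerator γ)]
        (𝔭 : HeightOneSpectrum (𝓞 K)) (h𝔭 : ((3 : ℕ) : 𝓞 K) ∈ 𝔭.asIdeal)
        (he : 𝔭.asIdeal.ramificationIdx (𝓞 ℚ) = 1) (hf : 𝔭.asIdeal.inertiaDeg (𝓞 ℚ) = 1),
        ∃ ι' : PadicAlgCl 3 ≃+* ℂ, SchneiderFree.BranchInducesPrime 3 ι' 𝔭 ∧
          ∃ (ΩK : ℂ) (Ωp : ℂ_[3]) (L : UnrSeries 3), ΩK ≠ 0 ∧ Ωp ≠ 0 ∧ IsBDPLFunction ι' 𝔭 κ γ Dt.f ΩK Ωp L ∧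
            ∃ u : (unrIntegers 3)ˣ, L.HasValueAt 0 ((((u : unrIntegers 3) : unrIntegers 3) : ℂ_[3]) *
              (algebraMap ℚ_[3] ℂ_[3] (logOmega W 3 (embAt K 3 𝔭 h𝔭 he hf) P / (Dt.c : ℚ_[3]))) ^ 2))
    (hC : WildSplitControlAtThree) (hZ : WildRankZeroTwistAtThree) :
    ∀ (W : WeierstrassCurve ℚ) [W.IsElliptic] [W.IsGloballyMinimal], Additive.ClassO6 W 3 →
      W.analyticRank = 1 → W.HasSurjectiveModNGaloisRep 3 →
      (∃ (W' : WeierstrassCurve ℚ) (_ : W'.IsElliptic) (_ : W'.IsGloballyMinimal),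
        O6.ModPCongruent W' W 3 ∧ ¬ Addv W' 3 ∧ W'.HasSurjectiveModNGaloisRep 3) → BSDp W 3 := by
  intro W _ _ hO6 hr hsurj htwin
  obtain ⟨hB, hS0⟩ := h3
  obtain ⟨W', hW'e, hW'm, hcong, hW'ss, hW'surj⟩ := htwin
  by_cases hgood : W'.HasGoodReductionAtPrime 3
  · by_cases hss : (3 : ℤ) ∣ W'.frobeniusTrace 3
    · -- good supersingular: trade `W′` for the supplied `a₃ = 0` twin `W″` (bucket C₀♭)
      obtain ⟨W'', hW''e, hW''m, hcong'', hW''ss, ha0⟩ :=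
        hsupply W hO6 hr hsurj ⟨W', hW'e, hW'm, hcong, hgood, by exact_mod_cast hss⟩
      have hW''surj : W''.HasSurjectiveModNGaloisRep 3 := by
        obtain ⟨e, he⟩ := hcong''
        refine GaloisImage.hasSurjectiveModNGaloisRep_of_torsionIso e.symm (fun σ Q ↦ ?_) hsurj
        apply e.injective
        rw [he, e.apply_symm_apply, e.apply_symm_apply]
      exact bsdp_three_of_twinWanFrameAt_odd_flat hF hT hV hC hZ W hO6 hr hsurj W'' hcong''
        (fun h ↦ h.1 hW''ss.1)
        (fun N' _ K _ _ Dt' hN hK hHK hodd κ hκ γ _ 𝔭 h𝔭 he hf 𝔭' h𝔭' hne ι' hι ↦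
          hS0 W'' N' K Dt' hW''ss ha0 hW''surj hN hK hHK hodd κ hκ γ 𝔭 h𝔭 he hf 𝔭' h𝔭' hne ι' hι)
    · -- good ordinary: bucket A from Yan–Zhu 5.7(1) ALONE, then the Wan clause with `k = 0`
      refine bsdp_three_of_twinWanFrameAt_odd_flat hF hT hV hC hZ W hO6 hr hsurj W' hcong hW'ss ?_
      intro N' _ K _ _ Dt' hN hK hH hodd κ hκ γ _ 𝔭 h𝔭 he hf 𝔭' h𝔭' hne ι' hι
      obtain ⟨⟨ΩK, Ωp, L', hΩK, hΩp, hBDP'⟩, hall⟩ :=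
        ThreeAdicImageOverK.twinSplitIMCAtThreeGoodOrd_of_yanZhu57 hYZ W' N' K Dt'
          ⟨hgood, by exact_mod_cast hss⟩ hW'surj hN hK hH hodd κ hκ γ 𝔭 h𝔭 he hf 𝔭' h𝔭' hne ι' hι
      refine ⟨ΩK, Ωp, L', hΩK, hΩp, hBDP', 0, fun G hG ↦ ?_⟩
      rw [hall ΩK Ωp L' hΩK hΩp hBDP'] at hG
      simpa using hG
  · -- multiplicative: bucket B♭
    have hmult : W'.HasMultiplicativeReductionAtPrime 3 := by
      by_contra h
      exact hW'ss ⟨hgood, h⟩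
    exact bsdp_three_of_twinWanFrameAt_odd_flat hF hT hV hC hZ W hO6 hr hsurj W' hcong hW'ss
      (fun N' _ K _ _ Dt' hN hK hHK hodd κ hκ γ _ 𝔭 h𝔭 he hf 𝔭' h𝔭' hne ι' hι ↦
        hB W' N' K Dt' hmult hW'surj hN hK hHK hodd κ hκ γ 𝔭 h𝔭 he hf 𝔭' h𝔭' hne ι' hι)

/-- **Act D's kernel♭ item `ToricKernelAtThreeApZeroOddFlatOfPrint` (stmt-BirchSwinnertonDyer-25913) holds**:
unpack the ♭ package and the printed leaves, derive control (crux #5) from the two Poitou–Tate leaves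
(`UniversalToricDescentControl.wildSplitControlAtThree_of_poitouTate`), V♯ from LZZ + the E-port as in the rev-31
kernel, and run the flat §3 re-run above. The type is literally the route decl (vet tk5d g7 (C3)). [folklore] -/
theorem toricKernelAtThreeApZeroOddFlatOfPrint_proof :
    Summit.BirchSwinnertonDyer.BirchSwinnertonDyer.Theses.UniversalToricDescent.ToricKernelAtThreeApZeroOddFlatOfPrint := by
  intro hF hT h3 hsupply hW hS hL hZ
  obtain ⟨hYZ, h1, h2⟩ := hL
  obtain ⟨hH, hB', hLZZ⟩ := hW
  exact bsdp_three_of_flat_of_nonOrdBuckets_odd hF hT hYZ h3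
    (fun W _ _ hO6 hr hsurj htwin ↦ hsupply W hO6 hr hsurj htwin)
    (UniversalToricDescentKernelOdd.wildSplitWaldspurgerAtThreeOdd_of_lzz_of_frameOdd hLZZ (hS hH hB'))
    (UniversalToricDescentControl.wildSplitControlAtThree_of_poitouTate h1 h2) hZ

/-- The route's rev-35 `closes` body with its kernel♭ hypothesis DISCHARGED by
`toricKernelAtThreeApZeroOddFlatOfPrint_proof`: the registered leaf `WAllExclAddWildRankOneSurjTwin` from the eight
remaining displayed hypotheses (CONDITIONAL on every one of them; closes nothing by itself). [folklore] -/
theorem wAllExclAddWildRankOneSurjTwin_of_flat_of_nonOrdBuckets_of_print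
    (hF : ToricPublishedInputs) (hT : ToricTransportModThreeFlat)
    (h3 : TwinWanFrameAtThreeNonOrdBuckets) (hsupply : GoodSSApZeroTwinSupplyAtThree)
    (hW : WildSplitPrintedInputsAtThree) (hS : WildSplitFrameAtThreeOddOfPrint)
    (hL : ToricPrintedLeavesAtThree) (hZ : WildRankZeroTwistAtThree) :
    Summit.BirchSwinnertonDyer.WAllExclAddWildRankOneSurjTwin :=
  Summit.BirchSwinnertonDyer.wAllExclAddWildRankOneSurjTwin_of_forall
    (toricKernelAtThreeApZeroOddFlatOfPrint_proof hF hT h3 hsupply hW hS hL hZ)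

end Summit.BirchSwinnertonDyer.BirchSwinnertonDyer.Theorems.UniversalToricDescentKernelFlatOfPrint

end
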